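import Literature.Analysis.FluidPDE.LeiZhang2011Cutoff
import Literature.Analysis.FluidPDE.PeriodicWindowIntegral
import HarnessLib

/-!
# The `z`-independent radial cut-offs `ψ_R(r)` of the periodic energy method

Analysis/FluidPDE proofs file (two auxiliary definitions, everything proved, no named facts), on
the discharge path of the named fact `Literature.Analysis.FluidPDE.leiRenZhang2019_liouville_periodic`
(Z. Lei, X. Ren, Q. S. Zhang, *On ancient periodic solutions to axially-symmetric Navier–Stokes
equations*, arXiv:1902.11229 = Math. Ann. 383 (2022), Theorem 1.1). In the local maximum estimate
(Lemma 2.1) and in §3 the swirl equation is tested on the periodic domains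
`P_R = D_R × (−R², 0]`, `D_R = {r < R} × [0, Z₀)`, against cut-offs depending on the distance to
the axis only: "choose `ψ₁(r,θ,z,s) = φ₁(r)η₁(s)` to be a smooth cut-off function … `supp φ ⊂ D_{σ₁}`,
`φ = 1` on `D_{σ₂}`, `0 ≤ φ ≤ 1`, `|∇φ| ≲ 1/(σ₁ − σ₂)` … `ψ_R(x,s) = φ₁(x/R)η₁(s/R²)`" ((2.2),
arXiv p. 5). "We emphasize that our choice of the cut-off function in the proof, together with the
periodicity of solutions, helps us gain the crucial effect of dimension reduction."

This file realises these cut-offs in the tree's vocabulary, as the tree's spherical cut-off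
`radialCutoff ρ₂ ρ₁` of Lei–Zhang 2011 (`LeiZhang2011Cutoff`) composed with the horizontal
projection:

* `horizPart` — the projection `x ↦ x_h = (x₀, x₁, 0)` (`‖x_h‖ = r`, `x_h = r e_r`);
* `cylCutoff ρ₂ ρ₁ = radialCutoff ρ₂ ρ₁ ∘ horizPart` — smooth, `[0,1]`-valued, `= 1` on
  `{r ≤ ρ₂}`, `= 0` on `{r ≥ ρ₁}`, axisymmetric, invariant under axial translations (hence
  axially periodic of every period), with `Dψ(x) = Dφ(x_h)` so that the bounds of
  `LeiZhang2011Cutoff` transfer verbatim: `ψ ∂ᵣψ ≤ 0` and `‖∇ψ‖ ≤ C/(ρ₁ − ρ₂)`; its gradient is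
  horizontal and radial, `∇ψ(x) = a(x) x_h` with a smooth, `z`-invariant, axisymmetric
  coefficient (`exists_gradient_cylCutoff_eq_smul_horizPart`) — the form in which the drift term
  `∫ v_r Λ² ∂ᵣψ²` of (2.3)–(2.4) is integrated by parts in `z`;
* calculus of products `x ↦ ψ(x) W(x₂)` with an axial profile `W` (derivative, gradient
  `W(x₂)∇ψ + ψ W'(x₂) e_z`, the radial derivative `W(x₂) ∂ᵣψ`, compact support when `ψ`
  vanishes off a cylinder and `W` off an interval), used with the periodic window
  `W = periodicWindow P` of `PeriodicWindowIntegral`;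
* `integrableOn_zSlab_of_eq_zero_of_le_cylRadius` — a continuous function vanishing off a
  cylinder is integrable on every period slab.

## References

* Z. Lei, X. Ren, Q. S. Zhang, arXiv:1902.11229, §2, (2.2) and the domains `D_R`, `P_R`
  (arXiv p. 5). [LeiRenZhang2019]
* Z. Lei, Q. S. Zhang, J. Funct. Anal. 261 (2011) = arXiv:1011.5066, §2 (2.1) (the radial
  cut-offs, tree `LeiZhang2011Cutoff`). [LeiZhang2011]
-/

noncomputable section

open MeasureTheory Set Function Filter Metric
open scoped InnerProductSpace RealInnerProductSpace NNReal ENNReal Topology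

namespace Literature.Analysis.FluidPDE

/-! ### Coordinates of the axial unit vector and of the radial unit vector (plumbing) -/

/-- `e_z 2 = 1`. [folklore] -/
@[simp] private theorem eZ_apply_two_cc : (eZ : EuclideanSpace ℝ (Fin 3)) 2 = 1 := by
  simp [eZ]

/-- `e_z 0 = 0`. [folklore] -/
@[simp] private theorem eZ_apply_zero_cc : (eZ : EuclideanSpace ℝ (Fin 3)) 0 = 0 := by
  simp [eZ]

/-- `e_z 1 = 0`. [folklore] -/
@[simp] private theorem eZ_apply_one_cc : (eZ : EuclideanSpace ℝ (Fin 3)) 1 = 0 := by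
  simp [eZ]

/-- `e_r 2 = 0`. [folklore] -/
@[simp] private theorem eR_apply_two_cc (x : EuclideanSpace ℝ (Fin 3)) : eR x 2 = 0 := by
  simp [eR]

/-- `⟪v, e_z⟫ = v 2`. [folklore] -/
private theorem inner_eZ_right_cc (v : EuclideanSpace ℝ (Fin 3)) : ⟪v, eZ⟫ = v 2 := by
  simp [PiLp.inner_apply, Fin.sum_univ_three]

/-- `⟪e_z, v⟫ = v 2`. [folklore] -/
private theorem inner_eZ_left_cc (v : EuclideanSpace ℝ (Fin 3)) : ⟪eZ, v⟫ = v 2 := by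
  rw [real_inner_comm, inner_eZ_right_cc]

/-! ### The horizontal projection -/

/-- **The horizontal projection** `x ↦ x_h = x − x₂ e_z = (x₀, x₁, 0)` onto the plane orthogonal
to the axis, as a continuous linear map; `‖x_h‖ = r` is the distance to the axis and
`x_h = r e_r` (the position part of the cylindrical coordinates `x = (r, θ, z)` of
Lei–Ren–Zhang, §2). [cite: LeiRenZhang2019, §2 (cylindrical coordinates x = (r, θ, z), arXiv p. 5)] -/
def horizPart : EuclideanSpace ℝ (Fin 3) →L[ℝ] EuclideanSpace ℝ (Fin 3) :=
  ContinuousLinearMap.id ℝ _ -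
    (EuclideanSpace.proj (2 : Fin 3) : EuclideanSpace ℝ (Fin 3) →L[ℝ] ℝ).smulRight eZ

/-- `x_h = x − x₂ e_z`. [cite: LeiRenZhang2019, §2 (cylindrical coordinates x = (r, θ, z) on D_R, arXiv p. 5)] -/
theorem horizPart_apply (x : EuclideanSpace ℝ (Fin 3)) : horizPart x = x - (x 2) • eZ := rfl

/-- `(x_h) 0 = x 0`. [cite: LeiRenZhang2019, §2 (cylindrical coordinates x = (r, θ, z) on D_R, arXiv p. 5)] -/
@[simp] theorem horizPart_apply_zero (x : EuclideanSpace ℝ (Fin 3)) : horizPart x 0 = x 0 := by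
  simp [horizPart_apply]

/-- `(x_h) 1 = x 1`. [cite: LeiRenZhang2019, §2 (cylindrical coordinates x = (r, θ, z) on D_R, arXiv p. 5)] -/
@[simp] theorem horizPart_apply_one (x : EuclideanSpace ℝ (Fin 3)) : horizPart x 1 = x 1 := by
  simp [horizPart_apply]

/-- `(x_h) 2 = 0`. [cite: LeiRenZhang2019, §2 (cylindrical coordinates x = (r, θ, z) on D_R, arXiv p. 5)] -/
@[simp] theorem horizPart_apply_two (x : EuclideanSpace ℝ (Fin 3)) : horizPart x 2 = 0 := by
  simp [horizPart_apply]

/-- `x = x_h + x₂ e_z`. [cite: LeiRenZhang2019, §2 (cylindrical coordinates x = (r, θ, z) on D_R, arXiv p. 5)] -/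
theorem horizPart_add_apply_two_smul_eZ (x : EuclideanSpace ℝ (Fin 3)) :
    horizPart x + (x 2) • eZ = x := by
  rw [horizPart_apply, sub_add_cancel]

/-- `x_h` as a coordinate vector: `x_h = (x₀, x₁, 0)`. [cite: LeiRenZhang2019, §2 (cylindrical coordinates x = (r, θ, z) on D_R, arXiv p. 5)] -/
theorem horizPart_eq_toLp (x : EuclideanSpace ℝ (Fin 3)) :
    horizPart x = WithLp.toLp 2 ![x 0, x 1, 0] := by
  ext i
  fin_cases i <;> simp

/-- `‖x_h‖² = x₀² + x₁²`. [cite: LeiRenZhang2019, §2 (cylindrical coordinates x = (r, θ, z) on D_R, arXiv p. 5)] -/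
theorem norm_horizPart_sq (x : EuclideanSpace ℝ (Fin 3)) : ‖horizPart x‖ ^ 2 = x 0 ^ 2 + x 1 ^ 2 := by
  rw [EuclideanSpace.real_norm_sq_eq]
  simp [Fin.sum_univ_three]

/-- `‖x_h‖ = r(x)`. [cite: LeiRenZhang2019, §2 (cylindrical coordinates x = (r, θ, z) on D_R, arXiv p. 5)] -/
theorem norm_horizPart (x : EuclideanSpace ℝ (Fin 3)) : ‖horizPart x‖ = cylRadius x := by
  rw [cylRadius, EuclideanSpace.norm_eq]
  congr 1
  simp [Fin.sum_univ_three, sq_abs]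

/-- `r(x_h) = r(x)`. [cite: LeiRenZhang2019, §2 (cylindrical coordinates x = (r, θ, z) on D_R, arXiv p. 5)] -/
theorem cylRadius_horizPart (x : EuclideanSpace ℝ (Fin 3)) : cylRadius (horizPart x) = cylRadius x := by
  simp [cylRadius]

/-- The horizontal projection commutes with the rotations about the axis. [cite: LeiRenZhang2019, §2 (cylindrical coordinates x = (r, θ, z) on D_R, arXiv p. 5)] -/
theorem horizPart_rotZ (θ : ℝ) (x : EuclideanSpace ℝ (Fin 3)) :
    horizPart (rotZ θ x) = rotZ θ (horizPart x) := by
  ext i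
  fin_cases i <;> simp [horizPart_apply]

/-- The horizontal projection does not see axial translations. [cite: LeiRenZhang2019, §2 (cylindrical coordinates x = (r, θ, z) on D_R, arXiv p. 5)] -/
theorem horizPart_add_smul_eZ (x : EuclideanSpace ℝ (Fin 3)) (t : ℝ) :
    horizPart (x + t • eZ) = horizPart x := by
  ext i
  fin_cases i <;> simp [horizPart_apply]

/-- `(e_z)_h = 0`. [cite: LeiRenZhang2019, §2 (cylindrical coordinates x = (r, θ, z) on D_R, arXiv p. 5)] -/
@[simp] theorem horizPart_eZ : horizPart (eZ : EuclideanSpace ℝ (Fin 3)) = 0 := by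
  ext i
  fin_cases i <;> simp [horizPart_apply]

/-- The horizontal projection is idempotent. [cite: LeiRenZhang2019, §2 (cylindrical coordinates x = (r, θ, z) on D_R, arXiv p. 5)] -/
theorem horizPart_horizPart (x : EuclideanSpace ℝ (Fin 3)) : horizPart (horizPart x) = horizPart x := by
  ext i
  fin_cases i <;> simp [horizPart_apply]

/-- `⟪x_h, v⟫ = x₀ v₀ + x₁ v₁`. [cite: LeiRenZhang2019, §2 (cylindrical coordinates x = (r, θ, z) on D_R, arXiv p. 5)] -/
theorem inner_horizPart_left (x v : EuclideanSpace ℝ (Fin 3)) : ⟪horizPart x, v⟫ = x 0 * v 0 + x 1 * v 1 := by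
  simp [PiLp.inner_apply, Fin.sum_univ_three]
  ring

/-- The horizontal projection is symmetric: `⟪x_h, v_h⟫ = ⟪x_h, v⟫`. [cite: LeiRenZhang2019, §2 (cylindrical coordinates x = (r, θ, z) on D_R, arXiv p. 5)] -/
theorem inner_horizPart_horizPart (x v : EuclideanSpace ℝ (Fin 3)) :
    ⟪horizPart x, horizPart v⟫ = ⟪horizPart x, v⟫ := by
  rw [inner_horizPart_left, inner_horizPart_left, horizPart_apply_zero, horizPart_apply_one]

/-- `x_h ⊥ e_z`. [cite: LeiRenZhang2019, §2 (cylindrical coordinates x = (r, θ, z) on D_R, arXiv p. 5)] -/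
theorem inner_horizPart_eZ (x : EuclideanSpace ℝ (Fin 3)) : ⟪horizPart x, eZ⟫ = 0 := by
  rw [inner_horizPart_left]
  simp

/-- `e_r(x_h) = e_r(x)`. [cite: LeiRenZhang2019, §2 (cylindrical coordinates x = (r, θ, z) on D_R, arXiv p. 5)] -/
theorem eR_horizPart (x : EuclideanSpace ℝ (Fin 3)) : eR (horizPart x) = eR x := by
  simp only [eR, cylRadius_horizPart, horizPart_apply_zero, horizPart_apply_one]

/-- `x_h = r e_r` (both sides vanish on the axis). [cite: LeiRenZhang2019, §2 (cylindrical coordinates x = (r, θ, z) on D_R, arXiv p. 5)] -/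
theorem horizPart_eq_cylRadius_smul_eR (x : EuclideanSpace ℝ (Fin 3)) :
    horizPart x = cylRadius x • eR x := by
  rw [eR, smul_smul, ← horizPart_eq_toLp]
  by_cases hr : cylRadius x = 0
  · have h0 := (cylRadius_eq_zero_iff x).1 hr
    have hx : horizPart x = 0 := by
      rw [horizPart_eq_toLp]
      ext i
      fin_cases i <;> simp [h0.1, h0.2]
    rw [hx, smul_zero]
  · rw [mul_inv_cancel₀ hr, one_smul]

/-- `⟪x_h, e_r⟫ = r`. [cite: LeiRenZhang2019, §2 (cylindrical coordinates x = (r, θ, z) on D_R, arXiv p. 5)] -/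
theorem inner_horizPart_eR (x : EuclideanSpace ℝ (Fin 3)) : ⟪horizPart x, eR x⟫ = cylRadius x := by
  rw [← eR_horizPart, LeiZhang2011.inner_self_eR_eq_cylRadius, cylRadius_horizPart]

/-- `‖x‖ ≤ r + |x₂|`. [cite: LeiRenZhang2019, §2 (cylindrical coordinates x = (r, θ, z) on D_R, arXiv p. 5)] -/
theorem norm_le_cylRadius_add_abs_apply_two (x : EuclideanSpace ℝ (Fin 3)) :
    ‖x‖ ≤ cylRadius x + |x 2| := by
  have h : ‖x‖ ^ 2 = cylRadius x ^ 2 + (x 2) ^ 2 := by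
    rw [EuclideanSpace.real_norm_sq_eq, cylRadius_sq, Fin.sum_univ_three]
  refine (pow_le_pow_iff_left₀ (norm_nonneg x) (add_nonneg (cylRadius_nonneg x) (abs_nonneg _)) two_ne_zero).1 ?_
  rw [h]
  nlinarith [abs_nonneg (x 2), cylRadius_nonneg x, sq_abs (x 2)]

/-! ### The cylindrical cut-off -/

/-- **The `z`-independent radial cut-off** `ψ(x) = φ_{ρ₂,ρ₁}(x_h)`, `φ_{ρ₂,ρ₁} = radialCutoff ρ₂ ρ₁`
the tree's smooth spherical cut-off (`= 1` on `‖·‖ ≤ ρ₂`, `= 0` on `‖·‖ ≥ ρ₁`): a smooth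
function of the distance to the axis, `ψ = 1` on the cylinder `{r ≤ ρ₂}`, `ψ = 0` off
`{r < ρ₁}` — the cut-offs "`supp φ ⊂ D_{σ₁}`, `φ = 1` on `D_{σ₂}`, `0 ≤ φ ≤ 1`,
`|∇φ| ≲ 1/(σ₁ − σ₂)`" of Lei–Ren–Zhang's (2.2) at radii `ρ₂ = σ₂R < ρ₁ = σ₁R`. [cite: LeiRenZhang2019, §2 (2.2) (the cut-offs φ(r) on D_R, arXiv p. 5)] -/
def cylCutoff (ρ₂ ρ₁ : ℝ) (x : EuclideanSpace ℝ (Fin 3)) : ℝ :=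
  radialCutoff ρ₂ ρ₁ (horizPart x)

/-- `ψ(x) = Θ(r²)` with the profile `Θ = cutoffProfile ρ₂ ρ₁` of the radial cut-off. [cite: LeiRenZhang2019, §2 (2.2) (the cut-offs φ(r) on D_R and their derivatives), arXiv p. 5] -/
theorem cylCutoff_eq_cutoffProfile (ρ₂ ρ₁ : ℝ) (x : EuclideanSpace ℝ (Fin 3)) :
    cylCutoff ρ₂ ρ₁ x = cutoffProfile ρ₂ ρ₁ (cylRadius x ^ 2) := by
  rw [cylCutoff, radialCutoff, norm_horizPart]

/-- `ψ` is smooth. [cite: LeiRenZhang2019, §2 (2.2) ("a smooth cut-off function"), arXiv p. 5] -/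
theorem contDiff_cylCutoff (ρ₂ ρ₁ : ℝ) {n : ℕ∞} : ContDiff ℝ n (cylCutoff ρ₂ ρ₁) :=
  (radialCutoff_contDiff ρ₂ ρ₁).comp horizPart.contDiff

/-- `0 ≤ ψ`. [cite: LeiRenZhang2019, §2 (2.2) (0 ≤ φ ≤ 1), arXiv p. 5] -/
theorem cylCutoff_nonneg (ρ₂ ρ₁ : ℝ) (x : EuclideanSpace ℝ (Fin 3)) : 0 ≤ cylCutoff ρ₂ ρ₁ x :=
  radialCutoff_nonneg _ _ _

/-- `ψ ≤ 1`. [cite: LeiRenZhang2019, §2 (2.2) (0 ≤ φ ≤ 1), arXiv p. 5] -/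
theorem cylCutoff_le_one (ρ₂ ρ₁ : ℝ) (x : EuclideanSpace ℝ (Fin 3)) : cylCutoff ρ₂ ρ₁ x ≤ 1 :=
  radialCutoff_le_one _ _ _

/-- `ψ = 1` on the cylinder `{r ≤ ρ₂}` (`0 ≤ ρ₂ < ρ₁`). [cite: LeiRenZhang2019, §2 (2.2) (φ = 1 on D_{σ₂}), arXiv p. 5] -/
theorem cylCutoff_eq_one {ρ₂ ρ₁ : ℝ} (h₀ : 0 ≤ ρ₂) (h₁ : ρ₂ < ρ₁) {x : EuclideanSpace ℝ (Fin 3)}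
    (hx : cylRadius x ≤ ρ₂) : cylCutoff ρ₂ ρ₁ x = 1 :=
  radialCutoff_eq_one h₀ h₁ (by rwa [norm_horizPart])

/-- `ψ = 0` off the cylinder `{r < ρ₁}` (`0 ≤ ρ₂ < ρ₁`). [cite: LeiRenZhang2019, §2 (2.2) (supp φ ⊂ D_{σ₁}), arXiv p. 5] -/
theorem cylCutoff_eq_zero {ρ₂ ρ₁ : ℝ} (h₀ : 0 ≤ ρ₂) (h₁ : ρ₂ < ρ₁) {x : EuclideanSpace ℝ (Fin 3)}
    (hx : ρ₁ ≤ cylRadius x) : cylCutoff ρ₂ ρ₁ x = 0 :=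
  radialCutoff_eq_zero h₀ h₁ (by rwa [norm_horizPart])

/-- `ψ` is axisymmetric. [cite: LeiRenZhang2019, §2 (2.2) (φ = φ(r)), arXiv p. 5] -/
theorem isAxisymmetricScalar_cylCutoff (ρ₂ ρ₁ : ℝ) : IsAxisymmetricScalar (cylCutoff ρ₂ ρ₁) := by
  intro θ x
  rw [cylCutoff, cylCutoff, horizPart_rotZ]
  exact radialCutoff_radial _ _ (norm_rotZ θ _)

/-- `ψ` is invariant under axial translations. [cite: LeiRenZhang2019, §2 (2.2) (φ = φ(r) independent of z), arXiv p. 5] -/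
theorem cylCutoff_add_smul_eZ (ρ₂ ρ₁ : ℝ) (x : EuclideanSpace ℝ (Fin 3)) (t : ℝ) :
    cylCutoff ρ₂ ρ₁ (x + t • eZ) = cylCutoff ρ₂ ρ₁ x := by
  rw [cylCutoff, cylCutoff, horizPart_add_smul_eZ]

/-- `ψ` is axially periodic of every period. [cite: LeiRenZhang2019, §2 (2.2) (φ = φ(r) on the periodic domain D_R), arXiv p. 5] -/
theorem isAxiallyPeriodic_cylCutoff (P ρ₂ ρ₁ : ℝ) : IsAxiallyPeriodic P (cylCutoff ρ₂ ρ₁) :=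
  fun x => cylCutoff_add_smul_eZ ρ₂ ρ₁ x P

/-- **The derivative of `ψ` is that of the spherical cut-off at `x_h`**: `Dψ(x) = Dφ(x_h)`
(`Dφ(x_h)` is a multiple of `⟪x_h, ·⟫`, which does not see the axial component). [cite: LeiRenZhang2019, §2 (2.2) (the cut-offs φ(r) on D_R and their derivatives), arXiv p. 5] -/
theorem hasFDerivAt_cylCutoff (ρ₂ ρ₁ : ℝ) (x : EuclideanSpace ℝ (Fin 3)) :
    HasFDerivAt (cylCutoff ρ₂ ρ₁)
      (fderiv ℝ (radialCutoff ρ₂ ρ₁ : EuclideanSpace ℝ (Fin 3) → ℝ) (horizPart x)) x := by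
  have h := (LeiZhang2011.hasFDerivAt_radialCutoff ρ₂ ρ₁ (horizPart x)).comp x horizPart.hasFDerivAt
  rw [(LeiZhang2011.hasFDerivAt_radialCutoff ρ₂ ρ₁ (horizPart x)).fderiv]
  refine h.congr_fderiv ?_
  ext v
  simp only [ContinuousLinearMap.coe_comp, Function.comp_apply, FunLike.coe_smul,
    Pi.smul_apply, _root_.neg_apply, innerSL_apply_apply, inner_horizPart_horizPart]

/-- `Dψ(x) = Dφ(x_h)`. [cite: LeiRenZhang2019, §2 (2.2) (the cut-offs φ(r) on D_R and their derivatives), arXiv p. 5] -/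
theorem fderiv_cylCutoff (ρ₂ ρ₁ : ℝ) (x : EuclideanSpace ℝ (Fin 3)) :
    fderiv ℝ (cylCutoff ρ₂ ρ₁) x =
      fderiv ℝ (radialCutoff ρ₂ ρ₁ : EuclideanSpace ℝ (Fin 3) → ℝ) (horizPart x) :=
  (hasFDerivAt_cylCutoff ρ₂ ρ₁ x).fderiv

/-- `∇ψ(x) = ∇φ(x_h)`. [cite: LeiRenZhang2019, §2 (2.2) (the cut-offs φ(r) on D_R and their derivatives), arXiv p. 5] -/
theorem gradient_cylCutoff (ρ₂ ρ₁ : ℝ) (x : EuclideanSpace ℝ (Fin 3)) :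
    gradient (cylCutoff ρ₂ ρ₁) x =
      gradient (radialCutoff ρ₂ ρ₁ : EuclideanSpace ℝ (Fin 3) → ℝ) (horizPart x) := by
  rw [gradient, gradient, fderiv_cylCutoff]

/-- **The gradient bound** `‖∇ψ‖ ≤ C/(ρ₁ − ρ₂)` with the absolute constant of the spherical
cut-off (`|∇φ| ≲ 1/(σ₁ − σ₂)` of (2.2), at radii `σᵢR`). [cite: LeiRenZhang2019, §2 (2.2) (|∇φ| ≲ 1/(σ₁−σ₂)), arXiv p. 5] -/
theorem exists_norm_gradient_cylCutoff_le :
    ∃ C : ℝ, 0 ≤ C ∧ ∀ (ρ₂ ρ₁ : ℝ), 0 ≤ ρ₂ → ρ₂ < ρ₁ → ∀ x : EuclideanSpace ℝ (Fin 3),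
      ‖gradient (cylCutoff ρ₂ ρ₁) x‖ ≤ C / (ρ₁ - ρ₂) := by
  obtain ⟨C, hC0, hC⟩ := LeiZhang2011.exists_norm_gradient_radialCutoff_le
  exact ⟨C, hC0, fun ρ₂ ρ₁ h₀ h₁ x => by rw [gradient_cylCutoff]; exact hC ρ₂ ρ₁ h₀ h₁ _⟩

/-- The same bound for the Fréchet derivative: `‖Dψ‖ ≤ C/(ρ₁ − ρ₂)`. [cite: LeiRenZhang2019, §2 (2.2) (|∇φ| ≲ 1/(σ₁−σ₂)), arXiv p. 5] -/
theorem exists_norm_fderiv_cylCutoff_le :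
    ∃ C : ℝ, 0 ≤ C ∧ ∀ (ρ₂ ρ₁ : ℝ), 0 ≤ ρ₂ → ρ₂ < ρ₁ → ∀ x : EuclideanSpace ℝ (Fin 3),
      ‖fderiv ℝ (cylCutoff ρ₂ ρ₁) x‖ ≤ C / (ρ₁ - ρ₂) := by
  obtain ⟨C, hC0, hC⟩ := LeiZhang2011.exists_norm_fderiv_radialCutoff_le
  exact ⟨C, hC0, fun ρ₂ ρ₁ h₀ h₁ x => by rw [fderiv_cylCutoff]; exact hC ρ₂ ρ₁ h₀ h₁ _⟩

/-- **Radial monotonicity** `ψ ∂ᵣψ ≤ 0` (`ρ₂ < ρ₁`, `0 ≤ ρ₂`): the axis term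
`∫ (2/r) Λ² ∂ᵣψ²` of (2.3) has a sign. [cite: LeiRenZhang2019, §2 (2.5) (the term (2/r)∂ᵣ of the energy identity), arXiv p. 6] -/
theorem cylCutoff_mul_fderiv_eR_nonpos {ρ₂ ρ₁ : ℝ} (h₁ : ρ₂ < ρ₁) (h₀ : 0 ≤ ρ₂)
    (x : EuclideanSpace ℝ (Fin 3)) :
    cylCutoff ρ₂ ρ₁ x * fderiv ℝ (cylCutoff ρ₂ ρ₁) x (eR x) ≤ 0 := by
  rw [fderiv_cylCutoff, ← eR_horizPart]
  exact LeiZhang2011.radialCutoff_mul_fderiv_eR_nonpos h₁ h₀ _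

/-- `∂_z ψ = 0`. [cite: LeiRenZhang2019, §2 (2.2) (φ = φ(r) independent of z), arXiv p. 5] -/
theorem fderiv_cylCutoff_eZ (ρ₂ ρ₁ : ℝ) (x : EuclideanSpace ℝ (Fin 3)) :
    fderiv ℝ (cylCutoff ρ₂ ρ₁) x eZ = 0 := by
  rw [fderiv_cylCutoff, (LeiZhang2011.hasFDerivAt_radialCutoff ρ₂ ρ₁ (horizPart x)).fderiv]
  simp only [FunLike.coe_smul, Pi.smul_apply, _root_.neg_apply,
    innerSL_apply_apply, inner_horizPart_eZ, smul_eq_mul, mul_zero, neg_zero]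

/-- `deriv smoothTransition` is smooth. [folklore] -/
private theorem contDiff_deriv_smoothTransition_cc {n : ℕ∞} :
    ContDiff ℝ n (deriv Real.smoothTransition) := by
  have h : ContDiff ℝ ((n + 1 : ℕ∞) : WithTop ℕ∞) Real.smoothTransition := Real.smoothTransition.contDiff
  have h' : ContDiff ℝ ((n : WithTop ℕ∞) + 1) Real.smoothTransition := by exact_mod_cast h
  exact h'.deriv'

/-- **The gradient of `ψ` is horizontal and radial**: `∇ψ(x) = a(x) x_h` for a smooth,
axisymmetric coefficient `a` invariant under axial translations (explicitly
`a = −2cΘ'(c(ρ₁² − r²))`, `c = (ρ₁² − ρ₂²)⁻¹`, `Θ = smoothTransition`). This is the form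
`∂ᵣψ e_r` of the gradient of a function of `r` used in (2.3)–(2.4). [cite: LeiRenZhang2019, §2 (2.3)–(2.4) (b·∇ψ² = v_r ∂ᵣψ²), arXiv pp. 5–6] -/
theorem exists_gradient_cylCutoff_eq_smul_horizPart (ρ₂ ρ₁ : ℝ) :
    ∃ a : EuclideanSpace ℝ (Fin 3) → ℝ, (∀ n : ℕ∞, ContDiff ℝ n a) ∧
      (∀ (x : EuclideanSpace ℝ (Fin 3)) (t : ℝ), a (x + t • eZ) = a x) ∧ IsAxisymmetricScalar a ∧
      ∀ x, gradient (cylCutoff ρ₂ ρ₁) x = a x • horizPart x := by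
  set c : ℝ := (ρ₁ ^ 2 - ρ₂ ^ 2)⁻¹ with hc
  refine ⟨fun x => deriv Real.smoothTransition (c * (ρ₁ ^ 2 - ‖horizPart x‖ ^ 2)) * (c * (-2)),
    fun n => ?_, fun x t => ?_, fun θ x => ?_, fun x => ?_⟩
  · refine (contDiff_deriv_smoothTransition_cc.comp ?_).mul contDiff_const
    exact contDiff_const.mul (contDiff_const.sub ((contDiff_norm_sq ℝ).comp horizPart.contDiff))
  · simp only [horizPart_add_smul_eZ]
  · simp only [horizPart_rotZ, norm_rotZ]
  · rw [gradient_cylCutoff, gradient, (LeiZhang2011.hasFDerivAt_radialCutoff ρ₂ ρ₁ (horizPart x)).fderiv]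
    apply ext_inner_right ℝ
    intro v
    simp only [InnerProductSpace.toDual_symm_apply, real_inner_smul_left, FunLike.coe_smul,
      Pi.smul_apply, _root_.neg_apply, innerSL_apply_apply, smul_eq_mul, ← hc]
    ring

/-- The norm of the gradient in the radial form: `‖∇ψ(x)‖ = |a(x)| r(x)`. [cite: LeiRenZhang2019, §2 (2.2) (the cut-offs φ(r) on D_R and their derivatives), arXiv p. 5] -/
theorem norm_smul_horizPart (a : ℝ) (x : EuclideanSpace ℝ (Fin 3)) :
    ‖a • horizPart x‖ = |a| * cylRadius x := by
  rw [norm_smul, Real.norm_eq_abs, norm_horizPart]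

/-! ### Products with an axial profile `x ↦ ψ(x) W(x₂)` -/

/-- **Derivative of `ψ(x) W(x₂)`**: `D(ψ W(x₂))(x) = W(x₂) Dψ(x) + ψ(x) W'(x₂) dx₂`. [cite: LeiRenZhang2019, §2 (2.2)–(2.3) (the cut-off ψ_R = φ(r)η and its derivatives), arXiv p. 5] -/
theorem hasFDerivAt_mul_comp_apply_two {ψ : EuclideanSpace ℝ (Fin 3) → ℝ}
    {ψ' : EuclideanSpace ℝ (Fin 3) →L[ℝ] ℝ} {W : ℝ → ℝ} {w' : ℝ} {x : EuclideanSpace ℝ (Fin 3)}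
    (hψ : HasFDerivAt ψ ψ' x) (hW : HasDerivAt W w' (x 2)) :
    HasFDerivAt (fun y => ψ y * W (y 2))
      (ψ x • (w' • (EuclideanSpace.proj (2 : Fin 3) : EuclideanSpace ℝ (Fin 3) →L[ℝ] ℝ)) +
        W (x 2) • ψ') x := by
  have h2 : HasFDerivAt (fun y : EuclideanSpace ℝ (Fin 3) => y 2)
      (EuclideanSpace.proj (2 : Fin 3) : EuclideanSpace ℝ (Fin 3) →L[ℝ] ℝ) x :=
    (EuclideanSpace.proj (2 : Fin 3) : EuclideanSpace ℝ (Fin 3) →L[ℝ] ℝ).hasFDerivAt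
  have hW' : HasFDerivAt (fun y : EuclideanSpace ℝ (Fin 3) => W (y 2))
      (w' • (EuclideanSpace.proj (2 : Fin 3) : EuclideanSpace ℝ (Fin 3) →L[ℝ] ℝ)) x :=
    hW.comp_hasFDerivAt x h2
  exact hψ.mul hW'

/-- `D(ψ W(x₂))(x)[v] = W(x₂) Dψ(x)[v] + ψ(x) W'(x₂) v₂`. [cite: LeiRenZhang2019, §2 (2.2)–(2.3) (the cut-off ψ_R = φ(r)η and its derivatives), arXiv p. 5] -/
theorem fderiv_mul_comp_apply_two {ψ : EuclideanSpace ℝ (Fin 3) → ℝ} {W : ℝ → ℝ}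
    {x : EuclideanSpace ℝ (Fin 3)} (hψ : DifferentiableAt ℝ ψ x) (hW : DifferentiableAt ℝ W (x 2))
    (v : EuclideanSpace ℝ (Fin 3)) :
    fderiv ℝ (fun y => ψ y * W (y 2)) x v = W (x 2) * fderiv ℝ ψ x v + ψ x * deriv W (x 2) * v 2 := by
  rw [(hasFDerivAt_mul_comp_apply_two hψ.hasFDerivAt hW.hasDerivAt).fderiv]
  simp only [_root_.add_apply, FunLike.coe_smul, Pi.smul_apply, smul_eq_mul,
    EuclideanSpace.coe_proj]
  ring

/-- `ψ(x) W(x₂)` is differentiable. [cite: LeiRenZhang2019, §2 (2.2)–(2.3) (the cut-off ψ_R = φ(r)η and its derivatives), arXiv p. 5] -/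
theorem differentiableAt_mul_comp_apply_two {ψ : EuclideanSpace ℝ (Fin 3) → ℝ} {W : ℝ → ℝ}
    {x : EuclideanSpace ℝ (Fin 3)} (hψ : DifferentiableAt ℝ ψ x) (hW : DifferentiableAt ℝ W (x 2)) :
    DifferentiableAt ℝ (fun y => ψ y * W (y 2)) x :=
  (hasFDerivAt_mul_comp_apply_two hψ.hasFDerivAt hW.hasDerivAt).differentiableAt

/-- **Gradient of `ψ(x) W(x₂)`**: `∇(ψ W(x₂))(x) = W(x₂) ∇ψ(x) + ψ(x) W'(x₂) e_z`. [cite: LeiRenZhang2019, §2 (2.2)–(2.3) (the cut-off ψ_R = φ(r)η and its derivatives), arXiv p. 5] -/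
theorem gradient_mul_comp_apply_two {ψ : EuclideanSpace ℝ (Fin 3) → ℝ} {W : ℝ → ℝ}
    {x : EuclideanSpace ℝ (Fin 3)} (hψ : DifferentiableAt ℝ ψ x) (hW : DifferentiableAt ℝ W (x 2)) :
    gradient (fun y => ψ y * W (y 2)) x = W (x 2) • gradient ψ x + (ψ x * deriv W (x 2)) • eZ := by
  apply ext_inner_right ℝ
  intro v
  rw [inner_gradient_left, fderiv_mul_comp_apply_two hψ hW, inner_add_left, real_inner_smul_left,
    real_inner_smul_left, inner_gradient_left, inner_eZ_left_cc]

/-- **Radial derivative of `ψ(x) W(x₂)`**: `∂ᵣ(ψ W(x₂)) = W(x₂) ∂ᵣψ` (`(e_r)₂ = 0`). [cite: LeiRenZhang2019, §2 (2.2)–(2.3) (the cut-off ψ_R = φ(r)η and its derivatives), arXiv p. 5] -/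
theorem fderiv_mul_comp_apply_two_eR {ψ : EuclideanSpace ℝ (Fin 3) → ℝ} {W : ℝ → ℝ}
    {x : EuclideanSpace ℝ (Fin 3)} (hψ : DifferentiableAt ℝ ψ x) (hW : DifferentiableAt ℝ W (x 2)) :
    fderiv ℝ (fun y => ψ y * W (y 2)) x (eR x) = W (x 2) * fderiv ℝ ψ x (eR x) := by
  rw [fderiv_mul_comp_apply_two hψ hW, eR_apply_two_cc, mul_zero, add_zero]

/-- **Axial derivative of `ψ(x) W(x₂)` for `z`-invariant `ψ`**: if `Dψ(x)[e_z] = 0` then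
`D(ψ W(x₂))(x)[e_z] = ψ(x) W'(x₂)`. [cite: LeiRenZhang2019, §2 (2.2)–(2.3) (the cut-off ψ_R = φ(r)η and its derivatives), arXiv p. 5] -/
theorem fderiv_mul_comp_apply_two_eZ {ψ : EuclideanSpace ℝ (Fin 3) → ℝ} {W : ℝ → ℝ}
    {x : EuclideanSpace ℝ (Fin 3)} (hψ : DifferentiableAt ℝ ψ x) (hW : DifferentiableAt ℝ W (x 2))
    (hz : fderiv ℝ ψ x eZ = 0) :
    fderiv ℝ (fun y => ψ y * W (y 2)) x eZ = ψ x * deriv W (x 2) := by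
  rw [fderiv_mul_comp_apply_two hψ hW, hz, eZ_apply_two_cc, mul_zero, zero_add, mul_one]

/-- `ψ(x) W(x₂)` is `Cⁿ` when `ψ` and `W` are. [cite: LeiRenZhang2019, §2 (2.2)–(2.3) (the cut-off ψ_R = φ(r)η and its derivatives), arXiv p. 5] -/
theorem contDiff_mul_comp_apply_two {ψ : EuclideanSpace ℝ (Fin 3) → ℝ} {W : ℝ → ℝ} {n : WithTop ℕ∞}
    (hψ : ContDiff ℝ n ψ) (hW : ContDiff ℝ n W) : ContDiff ℝ n fun y => ψ y * W (y 2) :=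
  hψ.mul (hW.comp (EuclideanSpace.proj (2 : Fin 3) : EuclideanSpace ℝ (Fin 3) →L[ℝ] ℝ).contDiff)

/-- `ψ(x) W(x₂)` is axisymmetric when `ψ` is. [cite: LeiRenZhang2019, §2 (2.2)–(2.3) (the cut-off ψ_R = φ(r)η and its derivatives), arXiv p. 5] -/
theorem isAxisymmetricScalar_mul_comp_apply_two {ψ : EuclideanSpace ℝ (Fin 3) → ℝ}
    (hψ : IsAxisymmetricScalar ψ) (W : ℝ → ℝ) : IsAxisymmetricScalar fun y => ψ y * W (y 2) := by
  intro θ x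
  simp only [hψ θ x, rotZ_apply_two]

/-- **Compact support**: if `ψ` vanishes off the cylinder `{r < ρ}` and `W` off `[−A, A]`, then
`ψ(x) W(x₂)` is supported in the closed ball of radius `ρ + A`. [cite: LeiRenZhang2019, §2 (2.2)–(2.3) (the cut-off ψ_R = φ(r)η and its derivatives), arXiv p. 5] -/
theorem mul_comp_apply_two_eq_zero_of_norm_gt {ψ : EuclideanSpace ℝ (Fin 3) → ℝ} {W : ℝ → ℝ}
    {ρ A : ℝ} (hψ : ∀ x, ρ ≤ cylRadius x → ψ x = 0) (hW : ∀ z, W z ≠ 0 → |z| ≤ A)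
    {x : EuclideanSpace ℝ (Fin 3)} (hx : ρ + A < ‖x‖) : ψ x * W (x 2) = 0 := by
  by_cases hW0 : W (x 2) = 0
  · rw [hW0, mul_zero]
  · have hA := hW _ hW0
    by_cases hr : ρ ≤ cylRadius x
    · rw [hψ x hr, zero_mul]
    · exfalso
      have h := norm_le_cylRadius_add_abs_apply_two x
      linarith [not_le.1 hr]

/-- `ψ(x) W(x₂)` has compact support when `ψ` vanishes off a cylinder and `W` off an interval. [cite: LeiRenZhang2019, §2 (2.2)–(2.3) (the cut-off ψ_R = φ(r)η and its derivatives), arXiv p. 5] -/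
theorem hasCompactSupport_mul_comp_apply_two {ψ : EuclideanSpace ℝ (Fin 3) → ℝ} {W : ℝ → ℝ}
    {ρ A : ℝ} (hψ : ∀ x, ρ ≤ cylRadius x → ψ x = 0) (hW : ∀ z, W z ≠ 0 → |z| ≤ A) :
    HasCompactSupport fun y => ψ y * W (y 2) := by
  refine HasCompactSupport.intro (isCompact_closedBall (0 : EuclideanSpace ℝ (Fin 3)) (ρ + A))
    fun x hx => ?_
  rw [mem_closedBall_zero_iff, not_le] at hx
  exact mul_comp_apply_two_eq_zero_of_norm_gt hψ hW hx

/-- The topological support of such a product lies in the closed ball of radius `ρ + A`. [cite: LeiRenZhang2019, §2 (2.2)–(2.3) (the cut-off ψ_R = φ(r)η and its derivatives), arXiv p. 5] -/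
theorem tsupport_mul_comp_apply_two_subset {ψ : EuclideanSpace ℝ (Fin 3) → ℝ} {W : ℝ → ℝ}
    {ρ A : ℝ} (hψ : ∀ x, ρ ≤ cylRadius x → ψ x = 0) (hW : ∀ z, W z ≠ 0 → |z| ≤ A) :
    tsupport (fun y => ψ y * W (y 2)) ⊆ closedBall (0 : EuclideanSpace ℝ (Fin 3)) (ρ + A) := by
  refine closure_minimal (fun x hx => ?_) isClosed_closedBall
  rw [mem_closedBall_zero_iff]
  by_contra h
  exact hx (mul_comp_apply_two_eq_zero_of_norm_gt hψ hW (not_le.1 h))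

/-! ### Integrability on a period slab -/

/-- **A continuous function vanishing off a cylinder is integrable on every period slab**
(the slab meets the cylinder in a bounded set). This is the finiteness of the integrals
`∫_{D_R} …` over one period of Lei–Ren–Zhang. [cite: LeiRenZhang2019, §2 (integrals over one period D_R = {r<R}×[0,Z₀)), arXiv p. 5] -/
theorem integrableOn_zSlab_of_eq_zero_of_le_cylRadius {Q : EuclideanSpace ℝ (Fin 3) → ℝ}
    (hQc : Continuous Q) {ρ : ℝ} (hQ0 : ∀ x, ρ ≤ cylRadius x → Q x = 0) (P : ℝ) (k : ℤ) :
    IntegrableOn Q (zSlab P k) volume := by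
  set Rb : ℝ := ρ + (|(k : ℝ) * P| + |P|) with hRb
  have hK : IntegrableOn Q (closedBall (0 : EuclideanSpace ℝ (Fin 3)) Rb) volume :=
    hQc.continuousOn.integrableOn_compact (isCompact_closedBall _ _)
  refine hK.of_forall_sdiff_eq_zero (measurableSet_zSlab P k) fun x hx => ?_
  obtain ⟨hxs, hxK⟩ := hx
  rw [mem_closedBall_zero_iff, not_le] at hxK
  rw [mem_zSlab] at hxs
  by_contra hQx
  have hr : cylRadius x < ρ := by
    by_contra h
    exact hQx (hQ0 x (not_lt.1 h))
  have h2 : |x 2| ≤ |(k : ℝ) * P| + |P| := by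
    obtain ⟨h1, h2⟩ := hxs
    have e : x 2 = (k : ℝ) * P + (x 2 - (k : ℝ) * P) := by ring
    rw [e]
    refine (abs_add_le _ _).trans (add_le_add le_rfl ?_)
    rw [abs_le]
    constructor
    · linarith [abs_nonneg P, neg_abs_le P]
    · have : x 2 - (k : ℝ) * P < P := by linarith
      linarith [le_abs_self P]
  have h := norm_le_cylRadius_add_abs_apply_two x
  linarith

end Literature.Analysis.FluidPDE

end
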